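import Literature.Probability.Percolation.SharpnessDCTProofs
import HarnessLib

/-!
# Crux `PercNonProliferation.SubpolynomialBlocking` (stmt-CriticalPhenomena-4446), line `SketchIdeator5` (two-sided charging floor) — stub `stub_outArm_le_siteToBoundary`

Helper file for the lead's skeleton of the line `SketchIdeator5` of the crux
`Summit.CriticalPhenomena.PercolationContinuityZ3.Theses.PercNonProliferation.SubpolynomialBlocking`.
Proves exactly the registered stub signature `stub_outArm_le_siteToBoundary`; lands with
`--supports stmt-CriticalPhenomena-4446`.

## The statement

For bond percolation on `ℤ³` at any parameter `p`, any `n ≥ 1` and any site `v` of the mid-sphere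
`∂ⁱⁿΛ_m`, `m = n + ⌊n/2⌋`, the outward arm
`outArm v n = {∃ y ∈ ∂ⁱⁿΛ_{2n}, v ⟷ y by an open path inside Λ_{2n}}` has probability at most
`P_p(0 ⟷ ∂ⁱⁿΛ_k inside Λ_k) = P_p(siteToBoundary 3 k)` with `k = n - ⌊n/2⌋`.

## The argument (first exit + translation invariance, Duminil-Copin–Tassion 2016, §2.1)

* Geometry (`StubOutArmLeSiteToBoundary.sub_notMem_or_mem_innerBoundary`): `v ∈ Λ_m` gives
  `|v_i| ≤ m` for all `i`; `y ∈ ∂ⁱⁿΛ_{2n}` gives a coordinate `y_j = ± 2n`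
  (`exists_eq_of_mem_innerBoundary_box`); hence `|y_j - v_j| ≥ 2n - m = k`, so either
  `y - v ∉ Λ_k`, or `y - v ∈ Λ_k` with `|(y - v)_j| = k`, i.e. `y - v ∈ ∂ⁱⁿΛ_k`
  (`DCT16.mem_innerBoundary_box_of_natAbs_eq`).
* First exit (`DCT16.armEvent_of_pathIn`): on a lattice configuration `ω ⊆ E(ℤ³)`, the open path
  from `v` to `y` (`DCT16.mem_openConnIn_iff_pathIn`) stopped at its first exit from `v + Λ_k`
  shows `ω ∈ DCT16.armEvent v k`; inclusions need only hold on lattice configurations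
  (`DCT16.real_mono_of_forall_subset_edgeSet`).
* Translation invariance (`DCT16.real_armEvent`): `P_p(armEvent v k) = P_p(siteToBoundary 3 k)`.

The hypothesis `1 ≤ n` of the registered signature is not needed. No new definitions.
-/

namespace Summit.CriticalPhenomena.PercolationContinuityZ3.Theorems.SubpolynomialBlocking

open MeasureTheory Filter Topology
open Literature.Probability.Percolation Literature.Probability.LatticeModels
open Literature.Probability.Percolation.DCT16

namespace StubOutArmLeSiteToBoundary

/-- **Geometry of the mid-sphere.** If `v ∈ Λ_{n + ⌊n/2⌋}` and `y ∈ ∂ⁱⁿΛ_{2n}` in `ℤ³`, then with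
`k = n - ⌊n/2⌋` either `y - v ∉ Λ_k` or `y - v ∈ ∂ⁱⁿΛ_k`: a coordinate `j` with `y_j = ± 2n` has
`|y_j - v_j| ≥ 2n - (n + ⌊n/2⌋) = k`. -/
theorem sub_notMem_or_mem_innerBoundary {n : ℕ} {v y : Site 3} (hv : v ∈ box 3 (n + n / 2))
    (hy : y ∈ innerBoundary (zdGraph 3) (box 3 (2 * n))) :
    y - v ∉ box 3 (n - n / 2) ∨ y - v ∈ innerBoundary (zdGraph 3) (box 3 (n - n / 2)) := by
  by_cases h : y - v ∈ box 3 (n - n / 2)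
  · refine Or.inr ?_
    obtain ⟨i, hi⟩ := exists_eq_of_mem_innerBoundary_box hy
    refine mem_innerBoundary_box_of_natAbs_eq h (i := i) ?_
    have hvi := (mem_box.1 hv) i
    have hki := (mem_box.1 h) i
    simp only [Pi.sub_apply] at hki ⊢
    push_cast at hvi hki hi
    omega
  · exact Or.inl h

/-- **Deterministic core.** On a lattice configuration `ω ⊆ E(ℤ³)`, an open path inside `Λ_{2n}`
from a site `v ∈ Λ_{n + ⌊n/2⌋}` to a site of `∂ⁱⁿΛ_{2n}` produces the translated one-arm event
`DCT16.armEvent v (n - ⌊n/2⌋)` (first exit from `v + Λ_{n - ⌊n/2⌋}`, `DCT16.armEvent_of_pathIn`). -/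
theorem mem_armEvent_of_outArm {n : ℕ} {v : Site 3} (hv : v ∈ box 3 (n + n / 2))
    {ω : BondConfig (Site 3)} (hω : ω ⊆ (zdGraph 3).edgeSet)
    (h : ω ∈ {ω | ∃ y ∈ innerBoundary (zdGraph 3) (box 3 (2 * n)),
      ω ∈ openConnIn (↑(box 3 (2 * n)) : Set (Site 3)) v y}) :
    ω ∈ DCT16.armEvent v (n - n / 2) := by
  obtain ⟨y, hy, hpath⟩ := h
  exact DCT16.armEvent_of_pathIn hω (DCT16.mem_openConnIn_iff_pathIn.1 hpath)
    (sub_notMem_or_mem_innerBoundary hv hy)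

end StubOutArmLeSiteToBoundary

/-- **Registered stub `stub_outArm_le_siteToBoundary`** (line `SketchIdeator5`, crux
`SubpolynomialBlocking`): for `v` on the mid-sphere `∂ⁱⁿΛ_{n + ⌊n/2⌋}` of `ℤ³`, the outward arm
`{∃ y ∈ ∂ⁱⁿΛ_{2n}, v ⟷ y inside Λ_{2n}}` is at most as likely as the one-arm event
`siteToBoundary 3 (n - ⌊n/2⌋) = {0 ⟷ ∂ⁱⁿΛ_{n - ⌊n/2⌋} inside Λ_{n - ⌊n/2⌋}}`: first exit from
`v + Λ_{n - ⌊n/2⌋}` (`StubOutArmLeSiteToBoundary.mem_armEvent_of_outArm`, valid on lattice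
configurations, `DCT16.real_mono_of_forall_subset_edgeSet`) and translation invariance
(`DCT16.real_armEvent`). (Duminil-Copin–Tassion 2016, §2.1.) -/
theorem stub_outArm_le_siteToBoundary :
    ∀ (p : unitInterval) (n : ℕ) (v : Site 3), 1 ≤ n → v ∈ innerBoundary (zdGraph 3) (box 3 (n + n / 2)) →
      (bondPercolation (zdGraph 3) p).real
          {ω | ∃ y ∈ innerBoundary (zdGraph 3) (box 3 (2 * n)),
            ω ∈ openConnIn (↑(box 3 (2 * n)) : Set (Site 3)) v y} ≤
        (bondPercolation (zdGraph 3) p).real (siteToBoundary 3 (n - n / 2)) := by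
  intro p n v _ hv
  rw [← DCT16.real_armEvent p v (n - n / 2)]
  exact DCT16.real_mono_of_forall_subset_edgeSet (zdGraph 3) p fun ω hω h =>
    StubOutArmLeSiteToBoundary.mem_armEvent_of_outArm (mem_innerBoundary_iff.1 hv).1 hω h

end Summit.CriticalPhenomena.PercolationContinuityZ3.Theorems.SubpolynomialBlocking
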